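import Literature.NumberTheory.CubicFields.PureCubicLexMinProgram
import Literature.NumberTheory.CubicFields.VoronoiRelativeMinima
import Literature.NumberTheory.NumberFields.PureCubicOrder
import HarnessLib

/-!
# The embeddings of a pure cubic field in coordinates

Topic `NumberTheory/CubicFields`, sub-namespace `PureCubicLexMin` (the specification vocabulary
`t1 a b = ∛(ab²)`, `t2 a b = ∛(a²b)` of `PureCubicLexMinProgram.lean`). Let `K` be a cubic number
field, `θ ∈ K` with `θ³ = ab²` (`ab` squarefree, `ab ≠ 1`), `θ₂ = θ²/b`, `σ₁ : K → ℝ` a real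
embedding and `σ₂ : K → ℂ` a non-real one. PROVED here (elementary; Cohen GTM 138 §6.4.5, and the
standard description of the embeddings of `ℚ(∛m)`):

* `t1_pow_three`, `t2_pow_three`, `t1_pos`, …, `t1_sq` (`t₁² = b t₂`), `t1_le` (`t₁ ≤ ab`);
* `sigma1_theta : σ₁ θ = t₁`, `sigma1_theta₂ : σ₁ θ₂ = t₂`, `sigma1_lin`;
* `im_sigma2_theta_ne_zero` (`θ` generates `K`, so a real value of `σ₂ θ` would make `σ₂` real),
  `sigma2_theta` : `σ₂ θ = t₁ (−1 ± i√3)/2`, `σ₂ θ₂ = t₂ (−1 ∓ i√3)/2`, whence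
  `sigma2_lin_re : Re σ₂(x + yθ + zθ₂) = x − (yt₁ + zt₂)/2` and
  `sigma2_lin_im : Im σ₂(x + yθ + zθ₂) = ±(√3/2)(yt₁ − zt₂)` (`exists_sign_sigma2_lin`).

## References

* H. Cohen, *A Course in Computational Algebraic Number Theory*, GTM 138 (1993), §6.4.5. [Cohen1993]
-/

noncomputable section

namespace Literature.NumberTheory.CubicFields

namespace PureCubicLexMin

open Literature.NumberTheory.NumberFields Literature.NumberTheory.NumberFields.MonicCubic
  Literature.NumberTheory.NumberFields.PureCubic
open scoped NumberField ComplexConjugate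

/-! ### The real cube roots `t₁`, `t₂` -/

section Roots

variable {a b : ℕ}

/-- `t₁³ = ab²`. [folklore] -/
theorem t1_pow_three (a b : ℕ) : t1 a b ^ 3 = ((a * b ^ 2 : ℕ) : ℝ) := by
  rw [t1, ← Real.rpow_natCast, ← Real.rpow_mul (Nat.cast_nonneg _)]
  norm_num

/-- `t₂³ = a²b`. [folklore] -/
theorem t2_pow_three (a b : ℕ) : t2 a b ^ 3 = ((a ^ 2 * b : ℕ) : ℝ) := by
  rw [t2, ← Real.rpow_natCast, ← Real.rpow_mul (Nat.cast_nonneg _)]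
  norm_num

/-- `0 ≤ t₁`. [folklore] -/
theorem t1_nonneg (a b : ℕ) : 0 ≤ t1 a b := Real.rpow_nonneg (Nat.cast_nonneg _) _

/-- `0 ≤ t₂`. [folklore] -/
theorem t2_nonneg (a b : ℕ) : 0 ≤ t2 a b := Real.rpow_nonneg (Nat.cast_nonneg _) _

/-- A nonnegative real is determined by its cube. [folklore] -/
theorem eq_of_pow_three_eq {x y : ℝ} (h : x ^ 3 = y ^ 3) : x = y :=
  (Odd.pow_inj (by decide : Odd 3)).1 h

/-- `1 ≤ t₁` when `a, b ≥ 1`. [folklore] -/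
theorem one_le_t1 (ha : 1 ≤ a) (hb : 1 ≤ b) : 1 ≤ t1 a b := by
  rw [← Odd.pow_le_pow (by decide : Odd 3), one_pow, t1_pow_three]
  exact_mod_cast Nat.one_le_iff_ne_zero.2 (by positivity)

/-- `1 ≤ t₂` when `a, b ≥ 1`. [folklore] -/
theorem one_le_t2 (ha : 1 ≤ a) (hb : 1 ≤ b) : 1 ≤ t2 a b := by
  rw [← Odd.pow_le_pow (by decide : Odd 3), one_pow, t2_pow_three]
  exact_mod_cast Nat.one_le_iff_ne_zero.2 (by positivity)

/-- `t₁ ≤ ab` (`ab² ≤ (ab)³`). [folklore] -/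
theorem t1_le (ha : 1 ≤ a) (hb : 1 ≤ b) : t1 a b ≤ (a * b : ℝ) := by
  rw [← Odd.pow_le_pow (by decide : Odd 3), t1_pow_three]
  have ha' : (1 : ℝ) ≤ a := by exact_mod_cast ha
  have hb' : (1 : ℝ) ≤ b := by exact_mod_cast hb
  have h1 : (1 : ℝ) ≤ a ^ 2 * b := one_le_mul_of_one_le_of_one_le (one_le_pow₀ ha') hb'
  have : (a * b ^ 2 : ℝ) ≤ (a * b) ^ 3 :=
    calc (a * b ^ 2 : ℝ) = a * b ^ 2 * 1 := by ring
      _ ≤ a * b ^ 2 * (a ^ 2 * b) := mul_le_mul_of_nonneg_left h1 (by positivity)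
      _ = (a * b) ^ 3 := by ring
  exact_mod_cast this

/-- `t₂ ≤ ab` (`a²b ≤ (ab)³`). [folklore] -/
theorem t2_le (ha : 1 ≤ a) (hb : 1 ≤ b) : t2 a b ≤ (a * b : ℝ) := by
  rw [← Odd.pow_le_pow (by decide : Odd 3), t2_pow_three]
  have ha' : (1 : ℝ) ≤ a := by exact_mod_cast ha
  have hb' : (1 : ℝ) ≤ b := by exact_mod_cast hb
  have h1 : (1 : ℝ) ≤ a * b ^ 2 := one_le_mul_of_one_le_of_one_le ha' (one_le_pow₀ hb')
  have : (a ^ 2 * b : ℝ) ≤ (a * b) ^ 3 :=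
    calc (a ^ 2 * b : ℝ) = a ^ 2 * b * 1 := by ring
      _ ≤ a ^ 2 * b * (a * b ^ 2) := mul_le_mul_of_nonneg_left h1 (by positivity)
      _ = (a * b) ^ 3 := by ring
  exact_mod_cast this

/-- `t₁² = b t₂` (both have cube `a²b⁴`). [folklore] -/
theorem t1_sq (a b : ℕ) : t1 a b ^ 2 = (b : ℝ) * t2 a b := by
  apply eq_of_pow_three_eq
  rw [show (t1 a b ^ 2) ^ 3 = (t1 a b ^ 3) ^ 2 by ring, mul_pow, t1_pow_three, t2_pow_three]
  push_cast
  ring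

/-- `t₁ t₂ = ab` (cube `a³b³`). [folklore] -/
theorem t1_mul_t2 (a b : ℕ) : t1 a b * t2 a b = (a * b : ℝ) := by
  apply eq_of_pow_three_eq
  rw [mul_pow, t1_pow_three, t2_pow_three]
  push_cast
  ring

end Roots

/-! ### The real embedding -/

section Real

variable {K : Type*} [Field K] {a b : ℕ} {θ : K} (σ₁ : K →+* ℝ)

/-- **`σ₁ θ = t₁`**: the real conjugate of `θ` is the real cube root of `ab²`. [folklore] -/
theorem sigma1_theta (hθ : θ ^ 3 = ((a * b ^ 2 : ℕ) : K)) : σ₁ θ = t1 a b := by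
  apply eq_of_pow_three_eq
  rw [← map_pow, hθ, map_natCast, t1_pow_three]

/-- **`σ₁ θ₂ = t₂`** (`θ₂ = θ²/b`, `b ≠ 0`). [folklore] -/
theorem sigma1_theta₂ (hθ : θ ^ 3 = ((a * b ^ 2 : ℕ) : K)) (hb : b ≠ 0) :
    σ₁ (θ ^ 2 / (b : K)) = t2 a b := by
  have hb' : (b : ℝ) ≠ 0 := Nat.cast_ne_zero.2 hb
  rw [map_div₀, map_pow, map_natCast, sigma1_theta σ₁ hθ, t1_sq, mul_div_cancel_left₀ _ hb']

/-- **The real conjugate in coordinates**: `σ₁ (x + yθ + zθ₂) = x + y t₁ + z t₂`. [folklore] -/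
theorem sigma1_lin (hθ : θ ^ 3 = ((a * b ^ 2 : ℕ) : K)) (hb : b ≠ 0) (r : PureCubicCodes.Row) :
    σ₁ (PureCubicCodes.lin θ b r) = (r.1 : ℝ) + r.2.1 * t1 a b + r.2.2 * t2 a b := by
  simp only [PureCubicCodes.lin, map_add, map_mul, map_intCast, sigma1_theta σ₁ hθ,
    sigma1_theta₂ σ₁ hθ hb]

end Real

/-! ### The complex embedding -/

section Complex

variable {K : Type*} [Field K] [NumberField K] {a b : ℕ} {θ : K} (σ₂ : K →+* ℂ)

/-- **`σ₂ θ` is not real** for a non-real embedding `σ₂`: `θ` generates `K` (`X³ − ab²` is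
irreducible of degree `3 = [K : ℚ]`), so `σ₂` and `conj ∘ σ₂` would agree on a generator. [folklore] -/
theorem im_sigma2_theta_ne_zero (hdeg : Module.finrank ℚ K = 3) (hab : Squarefree (a * b))
    (hab1 : a * b ≠ 1) (hθ : θ ^ 3 = ((a * b ^ 2 : ℕ) : K))
    (hσ₂ : ∃ z : K, conj (σ₂ z) ≠ σ₂ z) : (σ₂ θ).im ≠ 0 := by
  intro him
  have hirr := irreducible_polyQ (not_cube hab hab1)
  have hθ' := aeval_poly_of_cube_eq (m := a * b ^ 2) (θ := θ) (by exact_mod_cast hθ)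
  set pb := MonicCubic.pb hirr hθ' hdeg with hpb
  have hgen : pb.gen = θ := MonicCubic.pb_gen hirr hθ' hdeg
  have hreal : conj (σ₂ θ) = σ₂ θ := Complex.conj_eq_iff_im.2 him
  have key : (NumberField.ComplexEmbedding.conjugate σ₂).toRatAlgHom = σ₂.toRatAlgHom := by
    apply pb.algHom_ext
    rw [RingHom.toRatAlgHom_apply, RingHom.toRatAlgHom_apply, hgen,
      NumberField.ComplexEmbedding.conjugate_coe_eq, hreal]
  have key' : NumberField.ComplexEmbedding.conjugate σ₂ = σ₂ := by
    have := congrArg (fun f : K →ₐ[ℚ] ℂ => (f : K →+* ℂ)) key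
    simpa only [RingHom.toRatAlgHom_toRingHom] using this
  exact conjugate_ne_self σ₂ hσ₂ key'

/-- **The complex conjugates of `θ` and `θ₂`**: there is a sign `ε = ±1` with
`σ₂ θ = t₁ (−1/2 + ε i √3/2)` and `σ₂ θ₂ = t₂ (−1/2 − ε i √3/2)` (from `(σ₂ θ)³ = ab² = t₁³` with
`σ₂ θ ∉ ℝ`: writing `σ₂ θ = p + qi`, `3p²q = q³`, `q ≠ 0`, so `q² = 3p²`, `−8p³ = ab²`). [cite: Cohen1993, §6.4.5] -/
theorem sigma2_theta (hdeg : Module.finrank ℚ K = 3) (hab : Squarefree (a * b)) (hab1 : a * b ≠ 1)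
    (hθ : θ ^ 3 = ((a * b ^ 2 : ℕ) : K)) (hσ₂ : ∃ z : K, conj (σ₂ z) ≠ σ₂ z) :
    ∃ ε : ℝ, (ε = 1 ∨ ε = -1) ∧ (σ₂ θ).re = -(t1 a b) / 2 ∧ (σ₂ θ).im = ε * (Real.sqrt 3 / 2) * t1 a b ∧
      (σ₂ (θ ^ 2 / (b : K))).re = -(t2 a b) / 2 ∧
      (σ₂ (θ ^ 2 / (b : K))).im = -ε * (Real.sqrt 3 / 2) * t2 a b := by
  obtain ⟨-, hb0⟩ := ne_zero_of_squarefree_mul hab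
  have hq : (σ₂ θ).im ≠ 0 := im_sigma2_theta_ne_zero σ₂ hdeg hab hab1 hθ hσ₂
  set p := (σ₂ θ).re with hp
  set q := (σ₂ θ).im with hq'
  have hu : σ₂ θ = ⟨p, q⟩ := Complex.ext rfl rfl
  have hcube : (σ₂ θ) ^ 3 = ((a * b ^ 2 : ℕ) : ℂ) := by rw [← map_pow, hθ, map_natCast]
  rw [hu] at hcube
  have hre := congrArg Complex.re hcube
  have him := congrArg Complex.im hcube
  simp only [pow_succ, pow_zero, one_mul, Complex.mul_re, Complex.mul_im, Complex.natCast_re,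
    Complex.natCast_im] at hre him
  -- `3p²q = q³`, so `q² = 3p²`
  have hq2 : q ^ 2 = 3 * p ^ 2 := by
    have : q * (3 * p ^ 2 - q ^ 2) = 0 := by nlinarith
    rcases mul_eq_zero.1 this with h | h
    · exact absurd h hq
    · linarith
  -- `-8p³ = ab²`, so `-2p = t₁`
  have hp3 : (-2 * p) ^ 3 = ((a * b ^ 2 : ℕ) : ℝ) := by
    have : p ^ 3 - 3 * p * q ^ 2 = ((a * b ^ 2 : ℕ) : ℝ) := by push_cast at hre ⊢; nlinarith
    rw [hq2] at this
    nlinarith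
  have hpt : -2 * p = t1 a b := eq_of_pow_three_eq (by rw [hp3, t1_pow_three])
  have hpt' : p = -(t1 a b) / 2 := by linarith
  -- `q = ± (√3/2) t₁`
  have hq3 : q ^ 2 = (Real.sqrt 3 / 2 * t1 a b) ^ 2 := by
    rw [mul_pow, div_pow, Real.sq_sqrt (by norm_num), hq2, hpt']; ring
  obtain ⟨ε, hε, hqε⟩ : ∃ ε : ℝ, (ε = 1 ∨ ε = -1) ∧ q = ε * (Real.sqrt 3 / 2) * t1 a b := by
    rcases sq_eq_sq_iff_eq_or_eq_neg.1 hq3 with h | h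
    · exact ⟨1, Or.inl rfl, by rw [h]; ring⟩
    · exact ⟨-1, Or.inr rfl, by rw [h]; ring⟩
  have hε2 : ε ^ 2 = 1 := by rcases hε with rfl | rfl <;> norm_num
  -- `θ₂ = θ²/b`
  have hb' : (b : ℂ) ≠ 0 := Nat.cast_ne_zero.2 hb0
  have hθ₂ : σ₂ (θ ^ 2 / (b : K)) = (σ₂ θ) ^ 2 / (b : ℂ) := by rw [map_div₀, map_pow, map_natCast]
  have hsq : (σ₂ θ) ^ 2 = ⟨p ^ 2 - q ^ 2, 2 * p * q⟩ := by
    rw [hu]; apply Complex.ext <;> simp [pow_two]; ring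
  have hdivre : ((σ₂ θ) ^ 2 / (b : ℂ)).re = (p ^ 2 - q ^ 2) / b := by
    rw [hsq, Complex.div_natCast_re]
  have hdivim : ((σ₂ θ) ^ 2 / (b : ℂ)).im = (2 * p * q) / b := by
    rw [hsq, Complex.div_natCast_im]
  have hbR : (b : ℝ) ≠ 0 := Nat.cast_ne_zero.2 hb0
  refine ⟨ε, hε, hpt', hqε, ?_, ?_⟩
  · rw [hθ₂, hdivre, hq2, hpt', div_eq_iff hbR]
    have := t1_sq a b
    nlinarith
  · rw [hθ₂, hdivim, hqε, hpt', div_eq_iff hbR]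
    have := t1_sq a b
    linear_combination (-(ε * Real.sqrt 3 / 2)) * this

/-- **The complex conjugate in coordinates**: for some sign `ε = ±1` (depending on `σ₂` only),
`Re σ₂(x + yθ + zθ₂) = x − (y t₁ + z t₂)/2` and `Im σ₂(x + yθ + zθ₂) = ε (√3/2)(y t₁ − z t₂)` for all
integer rows `(x, y, z)`. [cite: Cohen1993, §6.4.5] -/
theorem exists_sign_sigma2_lin (hdeg : Module.finrank ℚ K = 3) (hab : Squarefree (a * b))
    (hab1 : a * b ≠ 1) (hθ : θ ^ 3 = ((a * b ^ 2 : ℕ) : K)) (hσ₂ : ∃ z : K, conj (σ₂ z) ≠ σ₂ z) :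
    ∃ ε : ℝ, (ε = 1 ∨ ε = -1) ∧ ∀ r : PureCubicCodes.Row,
      (σ₂ (PureCubicCodes.lin θ b r)).re = (r.1 : ℝ) - (r.2.1 * t1 a b + r.2.2 * t2 a b) / 2 ∧
      (σ₂ (PureCubicCodes.lin θ b r)).im = ε * (Real.sqrt 3 / 2) * (r.2.1 * t1 a b - r.2.2 * t2 a b) := by
  obtain ⟨ε, hε, h1, h2, h3, h4⟩ := sigma2_theta σ₂ hdeg hab hab1 hθ hσ₂
  refine ⟨ε, hε, fun r => ?_⟩
  simp only [PureCubicCodes.lin, map_add, map_mul, map_intCast, Complex.add_re, Complex.add_im,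
    Complex.mul_re, Complex.mul_im, Complex.intCast_re, Complex.intCast_im, h1, h2, h3, h4]
  constructor <;> ring

/-- **`‖σ₂ φ‖²` in coordinates**: `‖σ₂(x + yθ + zθ₂)‖² = (x − (yt₁ + zt₂)/2)² + (3/4)(yt₁ − zt₂)²`.
[cite: Cohen1993, §6.4.5] -/
theorem norm_sq_sigma2_lin (hdeg : Module.finrank ℚ K = 3) (hab : Squarefree (a * b))
    (hab1 : a * b ≠ 1) (hθ : θ ^ 3 = ((a * b ^ 2 : ℕ) : K)) (hσ₂ : ∃ z : K, conj (σ₂ z) ≠ σ₂ z)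
    (r : PureCubicCodes.Row) :
    ‖σ₂ (PureCubicCodes.lin θ b r)‖ ^ 2 = ((r.1 : ℝ) - (r.2.1 * t1 a b + r.2.2 * t2 a b) / 2) ^ 2 +
      3 / 4 * (r.2.1 * t1 a b - r.2.2 * t2 a b) ^ 2 := by
  obtain ⟨ε, hε, hr⟩ := exists_sign_sigma2_lin σ₂ hdeg hab hab1 hθ hσ₂
  obtain ⟨hre, him⟩ := hr r
  have hε2 : ε ^ 2 = 1 := by rcases hε with rfl | rfl <;> norm_num
  rw [← Complex.normSq_eq_norm_sq, Complex.normSq_apply, hre, him]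
  have h3 : Real.sqrt 3 ^ 2 = 3 := Real.sq_sqrt (by norm_num)
  linear_combination (3 / 4 * (↑r.2.1 * t1 a b - ↑r.2.2 * t2 a b) ^ 2) * hε2 +
    (ε ^ 2 / 4 * (↑r.2.1 * t1 a b - ↑r.2.2 * t2 a b) ^ 2) * h3

end Complex

end PureCubicLexMin

end Literature.NumberTheory.CubicFields

end
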